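import Mathlib
import HarnessLib
import Summits.HubbardSuperconductivity.HubbardSuperconductivity.Theorems.KLProgrammeKLRegimeEnginePairTransferMemberFlowX
import Literature.MathematicalPhysics.QuantumLattice.HubbardEffectiveActionCTTimeReversal

/-!
# Route `KLProgramme` — ENGINE child gen 8 (stmt-HubbardSuperconductivity-20437 `KLRegimeEngineV17F2`), skeleton v2 class #5 rev 3 / (E2-F2): PINNING the member's resolved
# Riccati defect to the `ω₀` arrays — `kltc_pinnedDefect_eq`, `klmc_sum_resolvedRung_eq_aggRate`
# (cell gate-hubbard-kl, seat hubbard-kl-k3c1-p1 g11, technique «composed-map remainder propagation»; the localisation step between `klmc_flow_source_eq` and `klmf_riccati_of_defect`)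

WHY.  `klmc_flow_source_eq` (p596258) names the Riccati defect of a member flow on the RESOLVED carrier `TorusSite × MatsubaraIdx` (rungs `ḃ(p,ν)`), while the class-#5 door
reads the `ω₀`-PINNED, ball-truncated arrays of `klmf_memberArray_flowData` with the frequency-AGGREGATED rungs `ḃ_agg(p)` of `klmf_rung_data`.  The two defects differ by an
explicit LOCALISATION term (KLTC v3/v4):
* **`kltc_pinnedDefect_eq`** (generic finite sums): for a resolved kernel `Γ`, resolved rungs `b′`, a pinning frequency `ω₀` and a truncation set `B`, with the pinned array
  `A(k,k′) = 𝟙[k,k′ ∈ B]·Γ((k,ω₀),(k′,ω₀))` and `ḃ_agg(p) = Σ_ν ḃ(p,ν)`: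
  `(A′ + A·diag ḃ_agg·A)(k,k′) = 𝟙[k,k′ ∈ B]·((Γ′ + Γ·diag ḃ·Γ)((k,ω₀),(k′,ω₀)) + Σ_{(p,ν)} ḃ(p,ν)·(𝟙[p ∈ B]·Γ((k,ω₀),(p,ω₀))Γ((p,ω₀),(k′,ω₀)) − Γ((k,ω₀),(p,ν))Γ((p,ν),(k′,ω₀))))`
  (`A′` the pinned truncation of `Γ′`) — resolved defect + localisation;
* **`klmc_sum_resolvedRung_eq_aggRate`** (model): for a symbol `ψ` EVEN in the frequency, the resolved member rungs of `klmc_flow_source_eq` aggregate to the rate of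
  `klmf_rung_data`: `Σ_ν ḃ(t)(p,ν) = ḃ_agg(t)(p)` (realness of the symmetrised pair sums, `klBubbleSum_im_eq_zero`).
Exact finite-sum algebra; nothing about the model's sizes is asserted; nothing asserts superconductivity.  0 kit.
-/

noncomputable section

namespace Summit.HubbardSuperconductivity.HubbardSuperconductivity.Theorems.KLRegimeWick

set_option linter.dupNamespace false -- summit = problem name (single-conjunct summit), D-0017

open Set Literature.MathematicalPhysics.QuantumLattice GrassmannAlgebra Finset Matrix
open Literature.Probability.LatticeModels
open Summit.HubbardSuperconductivity.HubbardSuperconductivity.Theorems.TwoPointAssembly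
open Summit.HubbardSuperconductivity.HubbardSuperconductivity.Theorems.KLProgrammeLegKernels
open Summit.HubbardSuperconductivity.HubbardSuperconductivity.Theorems.KLRegimeSplit

/-! ## §1 Pinning a resolved Riccati defect (generic) -/

section Generic

variable {S F : Type*} [Fintype S] [DecidableEq S] [Fintype F] [DecidableEq F]

/-- **Pinned defect = resolved defect at the pinned labels + localisation** (see the module docstring). -/
theorem kltc_pinnedDefect_eq (Γ Γ' : Matrix (S × F) (S × F) ℂ) (b' : S × F → ℂ) (ω₀ : F) (B : Finset S) (k k' : S) :
    ((Matrix.of fun k k' : S => if k ∈ B ∧ k' ∈ B then Γ' (k, ω₀) (k', ω₀) else 0) +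
        (Matrix.of fun k k' : S => if k ∈ B ∧ k' ∈ B then Γ (k, ω₀) (k', ω₀) else 0) *
          diagonal (fun p : S => ∑ ν : F, b' (p, ν)) *
        (Matrix.of fun k k' : S => if k ∈ B ∧ k' ∈ B then Γ (k, ω₀) (k', ω₀) else 0)) k k' =
      if k ∈ B ∧ k' ∈ B then
        (Γ' + Γ * diagonal b' * Γ) (k, ω₀) (k', ω₀) +
          ∑ z : S × F, b' z * ((if z.1 ∈ B then Γ (k, ω₀) (z.1, ω₀) * Γ (z.1, ω₀) (k', ω₀) else 0) - Γ (k, ω₀) z * Γ z (k', ω₀))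
      else 0 := by
  rw [Matrix.add_apply, klli_mul_diag_mul_apply]
  simp only [Matrix.of_apply]
  by_cases hkk : k ∈ B ∧ k' ∈ B
  · rw [if_pos hkk, if_pos hkk, Matrix.add_apply, klli_mul_diag_mul_apply]
    -- the pinned ladder sum over `p`, each `p` carrying `Σ_ν ḃ(p,ν)`
    have hpin : ∑ p : S, (if k ∈ B ∧ p ∈ B then Γ (k, ω₀) (p, ω₀) else 0) * (∑ ν : F, b' (p, ν)) *
        (if p ∈ B ∧ k' ∈ B then Γ (p, ω₀) (k', ω₀) else 0) =
        ∑ z : S × F, b' z * (if z.1 ∈ B then Γ (k, ω₀) (z.1, ω₀) * Γ (z.1, ω₀) (k', ω₀) else 0) := by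
      rw [Fintype.sum_prod_type]
      refine sum_congr rfl fun p _ => ?_
      rw [Finset.mul_sum, Finset.sum_mul]
      refine sum_congr rfl fun ν _ => ?_
      by_cases hp : p ∈ B
      · rw [if_pos ⟨hkk.1, hp⟩, if_pos ⟨hp, hkk.2⟩, if_pos hp]; ring
      · rw [if_neg (fun h => hp h.2), if_neg hp]; ring
    rw [hpin]
    have hres : ∑ b : S × F, Γ (k, ω₀) b * b' b * Γ b (k', ω₀) = ∑ z : S × F, b' z * (Γ (k, ω₀) z * Γ z (k', ω₀)) :=
      sum_congr rfl fun z _ => by ring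
    rw [hres]
    simp only [mul_sub, Finset.sum_sub_distrib]
    ring
  · rw [if_neg hkk, if_neg hkk, zero_add]
    refine sum_eq_zero fun p _ => ?_
    rcases not_and_or.mp hkk with hk | hk'
    · simp [hk]
    · simp [hk']

end Generic

/-! ## §2 The resolved member rungs aggregate to the rate of `klmf_rung_data` -/

section Model

variable (L M : ℕ) [NeZero L] (β μ : ℝ) (K : TrigPolyC4v)

omit [NeZero L] in
/-- The derivative weight is even in the frequency (the weight is, at every cutoff). -/
theorem klmc_derivWeight_revFreq (Λ : ℝ) (k : FreqMomentum L M) :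
    deriv (fun Λ' : ℝ => hubbardCutoffWeightCT L M β μ K Λ' (k.1.rev, k.2)) Λ = deriv (fun Λ' : ℝ => hubbardCutoffWeightCT L M β μ K Λ' k) Λ := by
  have h : (fun Λ' : ℝ => hubbardCutoffWeightCT L M β μ K Λ' (k.1.rev, k.2)) = fun Λ' : ℝ => hubbardCutoffWeightCT L M β μ K Λ' k := by
    funext Λ'; exact hubbardCutoffWeightCT_revFreq L M β μ K Λ' k
  rw [h]

omit [NeZero L] in
/-- The running symbol of an even symbol is even. -/
theorem klmc_runningSymbol_revFreq {ψ : FreqMomentum L M → ℝ} (hψ : ∀ k : FreqMomentum L M, ψ (k.1.rev, k.2) = ψ k) (Λ₁ Λ : ℝ)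
    (k : FreqMomentum L M) :
    ψ (k.1.rev, k.2) + (hubbardCutoffWeightCT L M β μ K Λ₁ (k.1.rev, k.2) - hubbardCutoffWeightCT L M β μ K Λ (k.1.rev, k.2)) =
      ψ k + (hubbardCutoffWeightCT L M β μ K Λ₁ k - hubbardCutoffWeightCT L M β μ K Λ k) := by
  rw [hψ, hubbardCutoffWeightCT_revFreq, hubbardCutoffWeightCT_revFreq]

/-- **The resolved member rungs of `klmc_flow_source_eq` aggregate over the frequency to the rate of `klmf_rung_data`** (for a symbol EVEN in the frequency — every
admissible one; realness of the symmetrised pair sums): at cutoff `Λ` with path coefficient `d = Λ₁ − Λ₀`,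
`Σ_ν c(p,ν)·d·(−ẇ_Λ(ν,p)φ_Λ(ν̄,Q−p) − φ_Λ(ν,p)ẇ_Λ(ν̄,Q−p)) = d·(B(ẇ_Λ,φ_Λ) + B(φ_Λ,ẇ_Λ))(Q,p)`, `c = −(βL²)⁻¹ĝĝ′`, `φ_Λ = ψ + (w_{Λ₁} − w_Λ)`. -/
theorem klmc_sum_resolvedRung_eq_aggRate (hβ : β ≠ 0) {ψ : FreqMomentum L M → ℝ} (hψ : ∀ k : FreqMomentum L M, ψ (k.1.rev, k.2) = ψ k) (Λ₁ Λ d : ℝ)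
    (Q p : TorusSite 2 L) :
    ∑ ν : MatsubaraIdx M,
        -((((β * (L : ℝ) ^ 2 : ℝ) : ℂ))⁻¹ * propCT L M β μ K (ν, p) * propCT L M β μ K (ν.rev, Q - p)) *
          (((d * (-deriv (fun Λ' : ℝ => hubbardCutoffWeightCT L M β μ K Λ' (ν, p)) Λ *
              (ψ (ν.rev, Q - p) + (hubbardCutoffWeightCT L M β μ K Λ₁ (ν.rev, Q - p) - hubbardCutoffWeightCT L M β μ K Λ (ν.rev, Q - p))) -
            (ψ (ν, p) + (hubbardCutoffWeightCT L M β μ K Λ₁ (ν, p) - hubbardCutoffWeightCT L M β μ K Λ (ν, p))) *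
              deriv (fun Λ' : ℝ => hubbardCutoffWeightCT L M β μ K Λ' (ν.rev, Q - p)) Λ)) : ℝ) : ℂ) =
      (((d * (klBubbleMass L M β μ K (fun k => deriv (fun Λ' : ℝ => hubbardCutoffWeightCT L M β μ K Λ' k) Λ)
            (fun k => ψ k + (hubbardCutoffWeightCT L M β μ K Λ₁ k - hubbardCutoffWeightCT L M β μ K Λ k)) Q p +
          klBubbleMass L M β μ K (fun k => ψ k + (hubbardCutoffWeightCT L M β μ K Λ₁ k - hubbardCutoffWeightCT L M β μ K Λ k))
            (fun k => deriv (fun Λ' : ℝ => hubbardCutoffWeightCT L M β μ K Λ' k) Λ) Q p)) : ℝ) : ℂ) := by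
  -- abbreviations
  set dw : FreqMomentum L M → ℝ := fun k => deriv (fun Λ' : ℝ => hubbardCutoffWeightCT L M β μ K Λ' k) Λ with hdw_def
  set ph : FreqMomentum L M → ℝ := fun k => ψ k + (hubbardCutoffWeightCT L M β μ K Λ₁ k - hubbardCutoffWeightCT L M β μ K Λ k) with hph_def
  have hdwe : ∀ k : FreqMomentum L M, dw (k.1.rev, k.2) = dw k := fun k => klmc_derivWeight_revFreq L M β μ K Λ k
  have hphe : ∀ k : FreqMomentum L M, ph (k.1.rev, k.2) = ph k := fun k => klmc_runningSymbol_revFreq L M β μ K hψ Λ₁ Λ k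
  -- the symmetrised pair sum is real
  set S : ℂ := klBubbleSum L M β μ K dw ph Q p + klBubbleSum L M β μ K ph dw Q p with hS
  have hreal : S.im = 0 := by
    rw [hS, Complex.add_im, klBubbleSum_im_eq_zero β μ K hdwe hphe, klBubbleSum_im_eq_zero β μ K hphe hdwe, add_zero]
  have hSre : ((S.re : ℝ) : ℂ) = S := by
    apply Complex.ext <;> simp [hreal]
  -- LHS = d·(βL²)⁻¹·S
  have hL : (L : ℝ) ≠ 0 := Nat.cast_ne_zero.2 (NeZero.ne L)
  have hb : (((β * (L : ℝ) ^ 2 : ℝ) : ℂ)) ≠ 0 := by exact_mod_cast mul_ne_zero hβ (pow_ne_zero 2 hL)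
  have hlhs : ∑ ν : MatsubaraIdx M,
      -((((β * (L : ℝ) ^ 2 : ℝ) : ℂ))⁻¹ * propCT L M β μ K (ν, p) * propCT L M β μ K (ν.rev, Q - p)) *
        (((d * (-dw (ν, p) * ph (ν.rev, Q - p) - ph (ν, p) * dw (ν.rev, Q - p))) : ℝ) : ℂ) =
      ((d : ℝ) : ℂ) * ((((β * (L : ℝ) ^ 2 : ℝ) : ℂ))⁻¹ * S) := by
    rw [hS, klBubbleSum, klBubbleSum, ← sum_add_distrib, Finset.mul_sum, Finset.mul_sum]
    refine sum_congr rfl fun ν _ => ?_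
    push_cast
    ring
  -- RHS = d·(βL²)⁻¹·Re S
  have hrhs : (((d * (klBubbleMass L M β μ K dw ph Q p + klBubbleMass L M β μ K ph dw Q p)) : ℝ) : ℂ) =
      ((d : ℝ) : ℂ) * ((((β * (L : ℝ) ^ 2 : ℝ) : ℂ))⁻¹ * ((S.re : ℝ) : ℂ)) := by
    rw [klBubbleMass, klBubbleMass, ← mul_add, ← Complex.add_re, ← hS]
    push_cast
    ring
  change ∑ ν : MatsubaraIdx M,
      -((((β * (L : ℝ) ^ 2 : ℝ) : ℂ))⁻¹ * propCT L M β μ K (ν, p) * propCT L M β μ K (ν.rev, Q - p)) *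
        (((d * (-dw (ν, p) * ph (ν.rev, Q - p) - ph (ν, p) * dw (ν.rev, Q - p))) : ℝ) : ℂ) =
      (((d * (klBubbleMass L M β μ K dw ph Q p + klBubbleMass L M β μ K ph dw Q p)) : ℝ) : ℂ)
  rw [hlhs, hrhs, hSre]

end Model

end Summit.HubbardSuperconductivity.HubbardSuperconductivity.Theorems.KLRegimeWick

end
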